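import Summits.QuantumFields.YangMills.Theses.ParabolicTrajectory

/-!
# `TunedSequenceExists` — negative lemma: the clause `2 ≤ M` is load-bearing

Dropping `2 ≤ M` from crux `TunedSequenceExists` (route ParabolicTrajectory, item
stmt-QuantumFields-10524) makes it false: at `M = 1` the shape clause `a_k = (M^{n_k})⁻¹ = 1`
contradicts `SpeciesScheme.tendsto_a` (`a_k → 0`). Stated relative to an inhabitant of
`IsCompactSimpleLieGroup` (e.g. `SU(2)` via the tree's named fact), so that the `∀ G` can be
instantiated. (cdisprove gen 2; the full adversary file is the crux workfile
`Summits/QuantumFields/YangMills/Cruxes/TunedSequenceExists/Disproof.lean`.)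
-/

namespace Summit.QuantumFields.YangMills.Theorems.TunedSequenceExists.Negative

open Filter Topology
open Literature.MathematicalPhysics.QuantumFieldTheory

/-- **`TunedSequenceExists` without `2 ≤ M` is false** as soon as one compact simple Lie group
exists: at `M = 1` no `M`-adic scheme exists at all. -/
theorem tunedSequenceExists_without_twoLeM_false {H : Type} [Group H] [TopologicalSpace H]
    [IsTopologicalGroup H] [CompactSpace H] (hH : IsCompactSimpleLieGroup H) :
    ¬ (∀ (G : Type) [Group G] [TopologicalSpace G] [IsTopologicalGroup G] [CompactSpace G],
        IsCompactSimpleLieGroup G → letI : MeasurableSpace G := borel G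
        haveI : BorelSpace G := ⟨rfl⟩
        ∀ (r : LatticeRep G) (M : ℕ), ∃ θ₀ : ℝ, 0 < θ₀ ∧ ∀ θ : ℝ, 0 < θ → θ < θ₀ →
          ∃ (sch : SpeciesScheme (YMSpecies G)) (n : ℕ → ℕ),
            (∀ k, sch.a k = ((M : ℝ) ^ n k)⁻¹) ∧ Tendsto sch.β atTop atTop ∧
            (∀ t : ℕ, 0 < t → ∃ c : ℝ, Tendsto (fun k => ((M : ℝ) ^ n k) ^ 8 *
                latticeConnectedCorr r.ρ (sch.β k) (sch.side k) r.curvature.F r.curvature.F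
                  (t * M ^ n k)) atTop (𝓝 c)) ∧
            Tendsto (fun k => ((M : ℝ) ^ n k) ^ 8 *
                latticeConnectedCorr r.ρ (sch.β k) (sch.side k) r.curvature.F r.curvature.F
                  (M ^ n k)) atTop (𝓝 θ)) := by
  intro h
  obtain ⟨r⟩ := hH.2
  letI : MeasurableSpace H := borel H
  haveI : BorelSpace H := ⟨rfl⟩
  obtain ⟨θ₀, hθ₀, hθ⟩ := h H hH r 1
  obtain ⟨sch, n, hshape, -, -, -⟩ := hθ (θ₀ / 2) (by positivity) (by linarith)
  have h1 : ∀ k, sch.a k = 1 := fun k => by rw [hshape k]; simp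
  have hfun : sch.a = fun _ => 1 := funext h1
  have hlim : Tendsto (fun _ : ℕ => (1 : ℝ)) atTop (𝓝 0) := hfun ▸ sch.tendsto_a
  have := tendsto_nhds_unique hlim tendsto_const_nhds
  norm_num at this

end Summit.QuantumFields.YangMills.Theorems.TunedSequenceExists.Negative
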